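import Mathlib
import HarnessLib
import Summits.NavierStokesRegularity.NavierStokesRegularity.Theorems.TaylorModelRungThreeCertificateFormatVBridge
import Summits.NavierStokesRegularity.NavierStokesRegularity.Theorems.TaylorModelRungThreeCertificateScalar

/-!
# Crux K1b-DR (stmt-NavierStokesRegularity-23954), line `taylor-model` — the v3 (VECTOR-STEP, frame-absorbed) certificate
# RECORD `CertTablesV` (CERT-CONTRACT-23954 v3.1 §2 as revised by PROPAGATE-V-SPEC-cert1 bcee1edc560e3a8a §1/§2 H and
# cert-1 g2's flat field list 09:39Z; director rulings dss_56/58/60)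

The v3 certificate = the v1 LIST-CODED tables `CertTables QS2` of `…CertificateFormat` for everything STATIC (window, degrees,
design constants, structure table `α`, effective coefficients `coef`, and per stage `S`, weights `ω`, scalars `bb κ Λ δ Lv as γ
Nσ lev dm ΛX`, faces `ell/ctr/rad/s`, `β/NDL`, section `σf`, `nx` — with EMPTY per-node / per-sub-step lists, so that the
landed `Static` / `StageNumerics` / field / window machinery written against `T : CertTables K` applies to `TV.base` verbatim),
PLUS the array-coded v3 dynamic part:

* global: `prec` (interval rounding precision, e.g. 64), `precB` (frame precision, e.g. 24), `pc` (centre jet order),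
  `pdegV` (variational order);
* per stage `StageV`: polytope scaling `D` (diagonal, point dyadics), box radii `rB` (= `r_j g_0` per coordinate), base point
  `yb` (= `x j 0`, exact dyadic), tube design constants `Λdes`, `cinfl` (exact), scaled stage Jacobian `Js` (landing block),
  EMITTED node states `nodesE` (`some` at chunk starts, `none` inside chunks — PROPAGATE-V-SPEC §2 E/H, F1/F2), and the
  sub-steps `steps`;
* per chunk-start node `NodeV` (cert-1 09:39Z (3)): `Vc` (n×n point, set parallelepiped AND derivative main part), `e` (plain
  set-error radii), `B` (error frame, low precision), `rp` (centre-error radii in `B`), `Z` (n×n interval derivative error in `B`);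
* per sub-step `StepV`: `h` (exact dyadic) and the next centre `xn = x_{s+1}` (exact dyadic point); an OPTIONAL emitted state
  box `lo/hi` (the checker builds its own); per stage two loosely-typed slots `entryAux` (Farkas data of the entry clause)
  and `landAux` (landing-block products) whose layout the respective checker files fix.

Readers with junk defaults (`stageV/stepV/nodeE`), the derived per-node scalars `hD`, `xD` (`x j 0 = yb`, `x j (s+1) = xn s`),
`TnD` (partial sums of `h`), and their real values. Nothing is checked or interpreted here (`…FormatVStep`: the checker's
per-sub-step computation and node recursion; `…FormatVInterp`: `toCertDataV/toBoxes/toRadii`). MODEL-lattice rung TL-M3 only;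
nothing here is a statement about the Navier–Stokes equations.
-/

-- the sub-problem namespace repeats the summit name by design (D-0017)
set_option linter.dupNamespace false

namespace Summit.NavierStokesRegularity.NavierStokesRegularity.Theorems.TaylorModelCert

open scoped BigOperators

/-! ### The v3 records -/

/-- EMITTED node state at a chunk start (PROPAGATE-V-SPEC rev. §1 «NODE STATE», cert-1 09:39Z (3)). [folklore] -/
structure NodeV where
  /-- point transport `Vc_s` (`n × n` dyadics) -/
  Vc : Array (Array Dyad)
  /-- plain set-error radii `e_s ≥ 0` (`n`) -/
  e : Array Dyad
  /-- error frame `B_s` (`n × n` point dyadics, low precision) -/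
  B : Array (Array Dyad)
  /-- centre-trajectory error radii `rp_s ≥ 0` in the frame `B_s` (`n`) -/
  rp : Array Dyad
  /-- derivative error `Z_s` in the frame `B_s` (`n × n` intervals) -/
  Z : Array (Array IntervalD)

/-- EMITTED per-sub-step data: step size and next centre. [folklore] -/
structure StepV where
  /-- step size `h_s > 0` (exact dyadic) -/
  h : Dyad
  /-- next centre `x_{s+1}` (exact dyadic point, `n`) -/
  xn : Array Dyad
  /-- OPTIONAL emitted a-priori state box `[lo, hi]` (size `0` = not provided; the checker builds its own and may ignore it) -/
  lo : Array Dyad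
  /-- see `lo` -/
  hi : Array Dyad

/-- Per-stage v3 data beyond `CertTables.stage`. [folklore] -/
structure StageV where
  /-- polytope scaling `D_j` (diagonal, `n` point dyadics): `q = yb + D_j ζ` -/
  D : Array Dyad
  /-- box radii of the parametrisation, `|ζ_c| ≤ rB_c` (`n`, `≥ 0`) -/
  rB : Array Dyad
  /-- base point `yb = x j 0` (exact dyadic, `n`) -/
  yb : Array Dyad
  /-- a-priori tube design constant `Λ^des_j` (exact) -/
  Λdes : QS2
  /-- tube inflation factor `c_infl` (exact) -/
  cinfl : QS2
  /-- scaled stage Jacobian `Js_j` (landing block; `n × n` dyadics) -/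
  Js : Array (Array Dyad)
  /-- emitted node states: `some` at chunk starts, `none` inside a chunk (`S + 1` entries; entry `0` unused) -/
  nodesE : Array (Option NodeV)
  /-- the `S` sub-steps -/
  steps : Array StepV
  /-- ENTRY data (Farkas multipliers for «polytope ⊆ yb + D·[±rB]»; layout fixed by the entry checker file) -/
  entryAux : Array (Array (Array QS2))
  /-- LANDING data (level products `Π^{(j)}_m` etc.; layout fixed by the `ReadoutsV` checker file) -/
  landAux : Array (Array (Array Dyad))

/-- **The v3 certificate record**: the v1 static tables over `ℚ(√2)` (per-node lists empty) + the array-coded vector-step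
data. [folklore] -/
structure CertTablesV where
  /-- v1-shaped static tables (window, degrees, constants, `α`, `coef`, per-stage scalars/faces/section; `nodes = steps = []`) -/
  base : CertTables QS2
  /-- rounding precision of the interval arithmetic (mantissa bits) -/
  prec : ℕ
  /-- precision of the checker-chosen frames (mantissa bits) -/
  precB : ℕ
  /-- order of the centre jets `pc` -/
  pc : ℕ
  /-- order of the variational jets `pdegV` -/
  pdegV : ℕ
  /-- per-stage v3 data -/
  stagesV : Array StageV

namespace CertTablesV

/-- The junk node state. [folklore] -/
def NodeV.dflt : NodeV := { Vc := #[], e := #[], B := #[], rp := #[], Z := #[] }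

/-- The junk sub-step. [folklore] -/
def StepV.dflt : StepV := { h := Dyad.zero, xn := #[], lo := #[], hi := #[] }

/-- The junk stage. [folklore] -/
def StageV.dflt : StageV :=
  { D := #[], rB := #[], yb := #[], Λdes := 0, cinfl := 0, Js := #[], nodesE := #[], steps := #[], entryAux := #[],
    landAux := #[] }

variable (TV : CertTablesV)

/-- Number of window coordinates. [folklore] -/
def n : ℕ := TV.base.n

/-- Stage v3 record (junk beyond the array). [folklore] -/
def stageV (j : ℕ) : StageV := if h : j < TV.stagesV.size then TV.stagesV[j] else StageV.dflt

/-- Sub-step record (junk beyond the array). [folklore] -/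
def stepV (j s : ℕ) : StepV :=
  if h : s < (TV.stageV j).steps.size then (TV.stageV j).steps[s] else StepV.dflt

/-- Emitted node state, if node `s` of stage `j` is a chunk start. [folklore] -/
def nodeE (j s : ℕ) : Option NodeV :=
  if h : s < (TV.stageV j).nodesE.size then (TV.stageV j).nodesE[s] else none

/-- Step size `h j s` (dyadic). [folklore] -/
def hD (j s : ℕ) : Dyad := (TV.stepV j s).h

/-- Centre `x j s` (dyadic point): the base point at `s = 0`, the emitted next centre afterwards. [folklore] -/
def xD (j : ℕ) : ℕ → Array Dyad
  | 0 => (TV.stageV j).yb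
  | s + 1 => (TV.stepV j s).xn

/-- Node time `Tn j s = Σ_{t<s} h j t` (exact dyadic). [folklore] -/
def TnD (j : ℕ) : ℕ → Dyad
  | 0 => Dyad.zero
  | s + 1 => Dyad.add (TnD j s) (TV.hD j s)

/-- Number of sub-steps of stage `j` (from the static tables). [folklore] -/
def S (j : ℕ) : ℕ := (TV.base.stage j).S

/-! ### Real values -/

/-- `h j s` as a real. [folklore] -/
noncomputable def hR (j s : ℕ) : ℝ := (TV.hD j s).toReal

/-- `Tn j s` as a real. [folklore] -/
noncomputable def TnR (j s : ℕ) : ℝ := (TV.TnD j s).toReal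

/-- The centre `x j s` as a window-supported shell state. [folklore] -/
noncomputable def xR (j s : ℕ) : Fin 4 → ℤ → ℝ := TV.base.vecF (vre (TV.xD j s))

/-- `Tn j 0 = 0`. [folklore] -/
@[simp] theorem TnR_zero (j : ℕ) : TV.TnR j 0 = 0 := by simp [TnR, TnD]

/-- `Tn j (s+1) = Tn j s + h j s`. [folklore] -/
theorem TnR_succ (j s : ℕ) : TV.TnR j (s + 1) = TV.TnR j s + TV.hR j s := by
  simp [TnR, TnD, hR]

/-- Window values of the centre. [folklore] -/
theorem wv_xR (j s : ℕ) {c : ℕ} (hc : c < TV.base.n) : TV.base.wv (TV.xR j s) c = vre (TV.xD j s) c :=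
  TV.base.wv_vecF _ hc

/-- The centre is window-supported. [folklore] -/
theorem xR_off (j s : ℕ) (i : Fin 4) {k : ℤ} (hk : ¬ (-TV.base.Kb ≤ k ∧ k ≤ TV.base.Ka)) : TV.xR j s i k = 0 :=
  TV.base.vecF_off _ i hk

end CertTablesV

end Summit.NavierStokesRegularity.NavierStokesRegularity.Theorems.TaylorModelCert
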